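import Literature.NumberTheory.GaloisCohomology.Howard2004.TowerReindex
import Literature.NumberTheory.GaloisCohomology.Howard2004.TowerMorphismPushforward
import HarnessLib

/-!
# Howard 2004, §1.6 / Rem. 1.2.4: a Kolyvagin system restricts to every cofinal sub-tower

Howard reads `H¹_F(K, T) = lim_k H¹_F(K, T/𝔪^k T)` along ANY cofinal system of levels [§1.6, arXiv:1202.6340
p. 12 L29–33]; the functoriality maps of Rem. 1.2.4 [p. 7 L13–27] between two tower settings exist level by
level only after re-indexing the source (μ-LEAD ruling 16:08Z (a): the open ideals `(q_m, p^{k+1})` of the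
Eisenstein target contain no `m`-independent cofinal family of source levels).  `Howard2004/TowerReindex.lean`
(lit g31) built the re-indexed setting `S.reindex s₀ d` (levels `σ k = idxSeq s₀ d k`, iterated reductions).
This file restricts Kolyvagin systems along it:

* `CoeffTowerSetting.rqIterH1` — `H¹` of the iterated quotient reduction, `rqIterH1_succ`;
* `CoeffTowerSetting.KolyvaginSystem.κ_redIter` — the level classes are compatible under ITERATED reductions;
* `AdicTower.redIterH1`, `redIterH1_succ`, `AdicTower.redIterH1_apply_of_mem_limitH1` — the same for families in `lim`;
* `CoeffTowerSetting.KolyvaginSystem.reindex κ : (S.reindex s₀ d).KolyvaginSystem` (`κ′^{(k)} := κ^{(σ k)}`,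
  `one′ k := one (σ k)`), `reindex_one`, `reindex_κ`.

Definitions with bodies and theorems; no named fact, no instance, no `sorry`.  BSD is not proved by any of this.

References: B. Howard, *The Heegner point Kolyvagin system*, Compositio Math. 140 (2004), §1.6 and Rem. 1.2.4
(arXiv:1202.6340, p. 12 L29–33, p. 7 L13–27).
-/

set_option autoImplicit false

noncomputable section

open Function NumberField IsDedekindDomain Field CategoryTheory
open scoped NumberField ContRepresentation Classical TensorProduct

namespace Literature.NumberTheory.GaloisCohomology.Howard2004

open Literature.NumberTheory.GaloisRepresentations
open Literature.NumberTheory.GaloisRepresentations.DiscreteGaloisModule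

/-! ## `H¹` of an identity-like map is the identity -/

section Identity

variable {K : Type} [Field K] {M : Type} [AddCommGroup M] [TopologicalSpace M] [DiscreteTopology M]

/-- `H¹(a) = id` on classes when `a x = x` pointwise. [cite: SerreGaloisCohomology1997, I §2.2] -/
theorem cohomologyMap_one_id_apply (τ : DiscreteGaloisModule K M) (a : M →+ M)
    (ha : ∀ (g : absoluteGaloisGroup K) (x : M), a (τ g x) = τ g (a x)) (h : ∀ x, a x = x)
    (c : galoisCohomology τ 1) :
    ContinuousRep.cohomologyMap τ τ a continuous_of_discreteTopology ha 1 c = c := by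
  obtain ⟨z, rfl⟩ := oneCocycleClass_surjective τ.toTopRep c
  rw [cohomologyMap_one_oneCocycleClass]
  congr 1
  exact Subtype.ext (ContinuousMap.ext fun g => h _)

end Identity

/-! ## Iterated reductions on `H¹` of a tower -/

namespace AdicTower

variable {K : Type} [Field K] [NumberField K] {R : Type} [CommRing R] [IsLocalRing R]
  {N : ℕ → Type} [∀ k, AddCommGroup (N k)] [∀ k, TopologicalSpace (N k)]
  [∀ k, DiscreteTopology (N k)] [∀ k, Module R (N k)]

/-- `H¹` of the iterated reduction `T_{k+d} → T_k`. [cite: Howard2004HeegnerKolyvagin, §1.6 (arXiv p. 12, L29–33)] -/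
def redIterH1 (T : AdicTower K R N) (k d : ℕ) :
    galoisCohomology (T.ρ (k + d)) 1 →+ galoisCohomology (T.ρ k) 1 :=
  ContinuousRep.cohomologyMap (T.ρ (k + d)) (T.ρ k) (T.redIter k d).toAddMonoidHom
    continuous_of_discreteTopology (T.redIter_equivariant k d) 1

omit [NumberField K] in
/-- `redIterH1 k 0 = id`. [cite: Howard2004HeegnerKolyvagin, §1.6 (arXiv p. 12)] -/
theorem redIterH1_zero (T : AdicTower K R N) (k : ℕ) (c : galoisCohomology (T.ρ k) 1) :
    T.redIterH1 k 0 c = c :=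
  cohomologyMap_one_id_apply (T.ρ k) (T.redIter k 0).toAddMonoidHom (T.redIter_equivariant k 0)
    (fun _ => rfl) c

omit [NumberField K] in
/-- `redIterH1 k (d+1) = redIterH1 k d ∘ redH1 (k+d)`. [cite: Howard2004HeegnerKolyvagin, §1.6 (arXiv p. 12)] -/
theorem redIterH1_succ (T : AdicTower K R N) (k d : ℕ) (c : galoisCohomology (T.ρ (k + d + 1)) 1) :
    T.redIterH1 k (d + 1) c = T.redIterH1 k d (T.redH1 (k + d) c) :=
  (cohomologyMap_one_comp_eq (T.ρ (k + d + 1)) (T.ρ (k + d)) (T.ρ k) (T.red (k + d)).toAddMonoidHom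
    (T.red_equivariant (k + d)) (T.redIter k d).toAddMonoidHom (T.redIter_equivariant k d)
    (T.redIter k (d + 1)).toAddMonoidHom (T.redIter_equivariant k (d + 1)) (fun _ => rfl) c).symm

omit [NumberField K] in
/-- A family in `lim_k H¹(K, T_k)` is compatible under the ITERATED reductions.
[cite: Howard2004HeegnerKolyvagin, §1.6 (arXiv p. 12, L29–33)] -/
theorem redIterH1_apply_of_mem_limitH1 (T : AdicTower K R N) {x : ∀ k, galoisCohomology (T.ρ k) 1}
    (hx : x ∈ T.limitH1) (k : ℕ) : ∀ d : ℕ, T.redIterH1 k d (x (k + d)) = x k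
  | 0 => T.redIterH1_zero k (x k)
  | d + 1 => by
    change T.redIterH1 k (d + 1) (x (k + d + 1)) = x k
    rw [redIterH1_succ, show T.redH1 (k + d) (x (k + d + 1)) = x (k + d) from hx (k + d),
      redIterH1_apply_of_mem_limitH1 T hx k d]

omit [NumberField K] in
/-- Unfolding: the reduction on `H¹` of the re-indexed tower is the iterated one.
[cite: Howard2004HeegnerKolyvagin, §1.6 (arXiv p. 12)] -/
theorem reindex_redH1 (T : AdicTower K R N) (s₀ : ℕ) (d : ℕ → ℕ) (k : ℕ) :
    (T.reindex s₀ d).redH1 k = T.redIterH1 (idxSeq s₀ d k) (d k) :=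
  rfl

end AdicTower

/-! ## Iterated quotient reductions on `H¹` and the restriction of a Kolyvagin system -/

namespace CoeffTowerSetting

variable {p : ℕ} [Fact p.Prime] {K : Type} [Field K] [NumberField K]
  {R : Type} [CommRing R] [IsLocalRing R] [Algebra ℤ_[p] R]
  {N : ℕ → Type} [∀ k, AddCommGroup (N k)] [∀ k, TopologicalSpace (N k)]
  [∀ k, DiscreteTopology (N k)] [∀ k, Module R (N k)]
  {Rk : ℕ → Type} [∀ k, CommRing (Rk k)] [∀ k, IsLocalRing (Rk k)] [∀ k, TopologicalSpace (Rk k)]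
  [∀ k, DiscreteTopology (Rk k)] [∀ k, Algebra ℤ_[p] (Rk k)] [∀ k, Algebra R (Rk k)]
  [∀ k, Module (Rk k) (N k)] [∀ k, IsScalarTower R (Rk k) (N k)]
  {Nbar : Type} [AddCommGroup Nbar] [TopologicalSpace Nbar] [DiscreteTopology Nbar]
  [∀ k, Module (Rk k) Nbar]
  {Nq : ℕ → Finset (HeightOneSpectrum (𝓞 K)) → Type} [∀ k n, AddCommGroup (Nq k n)]
  [∀ k n, TopologicalSpace (Nq k n)] [∀ k n, DiscreteTopology (Nq k n)]
  [∀ k n, Module (Rk k) (Nq k n)] [∀ k n, Module R (Nq k n)]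
  [∀ k n, IsScalarTower R (Rk k) (Nq k n)]

/-- `H¹` of the iterated quotient reduction `T^{(k+d)}/I_n → T^{(k)}/I_n`.
[cite: Howard2004HeegnerKolyvagin, Def. 1.2.3 / §1.6 (arXiv p. 7 L1–12, p. 11 L49–50)] -/
def rqIterH1 (S : CoeffTowerSetting p K R N Rk Nbar Nq) (k : ℕ) (n : Finset (HeightOneSpectrum (𝓞 K))) (d : ℕ) :
    galoisCohomology ((S.LD (k + d)).ρq n) 1 →+ galoisCohomology ((S.LD k).ρq n) 1 :=
  ContinuousRep.cohomologyMap ((S.LD (k + d)).ρq n) ((S.LD k).ρq n) (S.rqIter k n d).toAddMonoidHom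
    continuous_of_discreteTopology (S.rqIter_equivariant k n d) 1

/-- `rqIterH1 k n 0 = id`. [cite: Howard2004HeegnerKolyvagin, §1.6 (arXiv p. 11)] -/
theorem rqIterH1_zero (S : CoeffTowerSetting p K R N Rk Nbar Nq) (k : ℕ) (n : Finset (HeightOneSpectrum (𝓞 K)))
    (c : galoisCohomology ((S.LD k).ρq n) 1) : S.rqIterH1 k n 0 c = c :=
  cohomologyMap_one_id_apply ((S.LD k).ρq n) (S.rqIter k n 0).toAddMonoidHom (S.rqIter_equivariant k n 0)
    (fun _ => rfl) c

/-- `rqIterH1 k n (d+1) = rqIterH1 k n d ∘ rqH1 (k+d) n`. [cite: Howard2004HeegnerKolyvagin, §1.6 (arXiv p. 11, L49–50)] -/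
theorem rqIterH1_succ (S : CoeffTowerSetting p K R N Rk Nbar Nq) (k : ℕ) (n : Finset (HeightOneSpectrum (𝓞 K)))
    (d : ℕ) (c : galoisCohomology ((S.LD (k + d + 1)).ρq n) 1) :
    S.rqIterH1 k n (d + 1) c = S.rqIterH1 k n d (S.rqH1 (k + d) n c) :=
  (cohomologyMap_one_comp_eq ((S.LD (k + d + 1)).ρq n) ((S.LD (k + d)).ρq n) ((S.LD k).ρq n)
    (S.rq (k + d) n).toAddMonoidHom (S.rq_equivariant (k + d) n) (S.rqIter k n d).toAddMonoidHom
    (S.rqIter_equivariant k n d) (S.rqIter k n (d + 1)).toAddMonoidHom (S.rqIter_equivariant k n (d + 1))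
    (fun _ => rfl) c).symm

/-- Unfolding: `rqH1` of the re-indexed setting is the iterated one.
[cite: Howard2004HeegnerKolyvagin, §1.6 (arXiv p. 11, L49–50)] -/
theorem reindex_rqH1 (S : CoeffTowerSetting p K R N Rk Nbar Nq) (s₀ : ℕ) (d : ℕ → ℕ) (k : ℕ)
    (n : Finset (HeightOneSpectrum (𝓞 K))) :
    (S.reindex s₀ d).rqH1 k n = S.rqIterH1 (idxSeq s₀ d k) n (d k) :=
  rfl

namespace KolyvaginSystem

variable {S : CoeffTowerSetting p K R N Rk Nbar Nq}

/-- **The level classes of a Kolyvagin system are compatible under the ITERATED reductions**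
(`κ_red` iterated): `(rqIterH1 ⊗ 1) κ^{(k+d)}_n = κ^{(k)}_n` in `H¹(K, T^{(k)}/I_n) ⊗ G_n`.
[cite: Howard2004HeegnerKolyvagin, Def. 1.2.3 / §1.6 (arXiv p. 7 L1–12, p. 11 L49–50)] -/
theorem κ_redIter (κ : S.KolyvaginSystem) (k : ℕ) (n : Finset (HeightOneSpectrum (𝓞 K))) :
    ∀ d : ℕ,
      TensorProduct.map ((S.rqIterH1 k n d).comp ((S.LD (k + d)).selmerAt S.jbar n).subtype).toIntLinearMap
          LinearMap.id (κ.κ (k + d) n) =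
        TensorProduct.map ((S.LD k).selmerAt S.jbar n).subtype.toIntLinearMap LinearMap.id (κ.κ k n)
  | 0 => by
    have h0 : (S.rqIterH1 k n 0).comp ((S.LD (k + 0)).selmerAt S.jbar n).subtype =
        ((S.LD k).selmerAt S.jbar n).subtype :=
      AddMonoidHom.ext fun c => S.rqIterH1_zero k n c
    exact congrArg (fun F : ↥((S.LD k).selmerAt S.jbar n) →+ galoisCohomology ((S.LD k).ρq n) 1 =>
      TensorProduct.map F.toIntLinearMap (LinearMap.id : Gn (K := K) n →ₗ[ℤ] Gn (K := K) n) (κ.κ k n)) h0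
  | d + 1 => by
    change TensorProduct.map ((S.rqIterH1 k n (d + 1)).comp
        ((S.LD (k + d + 1)).selmerAt S.jbar n).subtype).toIntLinearMap LinearMap.id (κ.κ (k + d + 1) n) = _
    -- `(rqIterH1 (d+1) ∘ subtype) ⊗ 1 = ((rqIterH1 d) ⊗ 1) ∘ ((rqH1 ∘ subtype) ⊗ 1)`
    have hsplit :
        TensorProduct.map ((S.rqIterH1 k n (d + 1)).comp
            ((S.LD (k + d + 1)).selmerAt S.jbar n).subtype).toIntLinearMap LinearMap.id =
          TensorProduct.map (S.rqIterH1 k n d).toIntLinearMap LinearMap.id ∘ₗ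
            TensorProduct.map ((S.rqH1 (k + d) n).comp
              ((S.LD (k + d + 1)).selmerAt S.jbar n).subtype).toIntLinearMap
              (LinearMap.id : Gn (K := K) n →ₗ[ℤ] Gn (K := K) n) := by
      rw [← TensorProduct.map_comp, LinearMap.comp_id]
      congr 1
      refine LinearMap.ext fun c => ?_
      simp only [AddMonoidHom.coe_toIntLinearMap, AddMonoidHom.coe_comp, Function.comp_apply,
        LinearMap.coe_comp]
      exact S.rqIterH1_succ k n d _
    have hmerge :
        TensorProduct.map (S.rqIterH1 k n d).toIntLinearMap LinearMap.id ∘ₗ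
            TensorProduct.map ((S.LD (k + d)).selmerAt S.jbar n).subtype.toIntLinearMap
              (LinearMap.id : Gn (K := K) n →ₗ[ℤ] Gn (K := K) n) =
          TensorProduct.map ((S.rqIterH1 k n d).comp ((S.LD (k + d)).selmerAt S.jbar n).subtype).toIntLinearMap
            LinearMap.id := by
      rw [← TensorProduct.map_comp, LinearMap.comp_id]
      rfl
    rw [hsplit, LinearMap.comp_apply, κ.κ_red (k + d) n, ← LinearMap.comp_apply, hmerge]
    exact κ_redIter κ k n d

/-- **Restriction of a Kolyvagin system to the cofinal sub-tower** `σ = idxSeq s₀ d`: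
`κ′^{(k)} := κ^{(σ k)}`, `one′ k := one (σ k)`.
[cite: Howard2004HeegnerKolyvagin, §1.6 and Rem. 1.2.4 (arXiv p. 12 L29–33, p. 7 L13–27)] -/
def reindex (κ : S.KolyvaginSystem) (s₀ : ℕ) (d : ℕ → ℕ) : (S.reindex s₀ d).KolyvaginSystem where
  κ k := κ.κ (idxSeq s₀ d k)
  ks k := κ.ks (idxSeq s₀ d k)
  κ_red k n := κ.κ_redIter (idxSeq s₀ d k) n (d k)
  one k := κ.one (idxSeq s₀ d k)
  one_mem := by
    have hmem := (AdicTower.mem_limitSelmer_iff _ _ _).mp κ.one_mem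
    refine (AdicTower.mem_limitSelmer_iff _ _ _).mpr ⟨fun k => ?_, fun k => hmem.2 _⟩
    exact S.T.redIterH1_apply_of_mem_limitH1 hmem.1 (idxSeq s₀ d k) (d k)
  κ_one k := κ.κ_one (idxSeq s₀ d k)

/-- The bottom class of the restricted system at level `k` is `one (σ k)`.
[cite: Howard2004HeegnerKolyvagin, §1.6 (arXiv p. 12, L29–33)] -/
@[simp] theorem reindex_one (κ : S.KolyvaginSystem) (s₀ : ℕ) (d : ℕ → ℕ) (k : ℕ) :
    (κ.reindex s₀ d).one k = κ.one (idxSeq s₀ d k) :=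
  rfl

/-- The level classes of the restricted system. [cite: Howard2004HeegnerKolyvagin, Rem. 1.2.4 (arXiv p. 7, L13–27)] -/
@[simp] theorem reindex_κ (κ : S.KolyvaginSystem) (s₀ : ℕ) (d : ℕ → ℕ) (k : ℕ)
    (n : Finset (HeightOneSpectrum (𝓞 K))) :
    (κ.reindex s₀ d).κ k n = κ.κ (idxSeq s₀ d k) n :=
  rfl

end KolyvaginSystem

end CoeffTowerSetting

end Literature.NumberTheory.GaloisCohomology.Howard2004

end
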